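import Summits.CriticalPhenomena.PercolationContinuityZ3.Theorems.PercAnnulusCrossingIICAspectLevelTwoSided
import HarnessLib

/-!
# Kesten–Basu–Sapozhnikov IIC scheme in boxes, NEAR-CRITICAL series II: the two-sided one-level decomposition for an ABSTRACT junk weight
# (lane RSW3, p1 gen 6)

builds on p205010 (kernel theorem, internal audit signed; external expert review pending)

Seat `prim-rsw3-p1` (gen 6).  Part VII′ (`PercAnnulusCrossingIICAspectLevelTwoSided.lean`) re-threaded for an ABSTRACT junk weight
`J : ℕ → ℕ → ℝ`: instead of deriving the level junk `ϰ² · P(CONN ∩ NONUNIQ(σ m₁, σ m₂)) ≤ α(σ m₁, σ m₂) · P(CONN)` from (A2)□ (part VI′), the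
inequality `ϰ² · P(CONN(H,X;n) ∩ NONUNIQ(σ m₁, σ m₂)) ≤ J m₁ m₂ · P(CONN(H,X;n))` is taken as the hypothesis `hJ` (for all admissible
`m₁ ≤ m₂`, `τ m₁ < σ m₂`, `τ m₂ < n`, holes `H ⊆ Λ(m₁ − 1)` and sources `X ⊆ Λ(m₁) ∖ H`).  Instances: `J m₁ m₂ = α(σ m₁, σ m₂)` (part VI′, the
`θ(p) = 0` series) and `J m₁ m₂ = √P(NONUNIQ(σ m₁, σ m₂))` (near-critical series I, `real_conn_inter_nonuniq_le_sqrt_of_setToSetQM_aspect`,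
Basu–Sapozhnikov's `ε_i`, small at every `p` by uniqueness).  Proof = part VII′ verbatim.  Helper file; no definitions, no sorries; every `p`, `d`.
* **`sum_real_level_two_sided_junk`** — `P(E ∩ CONN(H,X;n)) − ϰ⁻² J m₁ m₂ · P(CONN(H,X;n)) ≤ Σ_{(U,R)} P(E ∩ DAT ∩ LINK' ∩ LEFT)·P(CONN(U,R;n))
  ≤ P(E ∩ CONN(H,X;n))` (Basu–Sapozhnikov (2.5)/(2.6) with hole and source, abstract junk).
References: D. Basu, A. Sapozhnikov, ECP 22 (2017) no. 26, §2 (2.4)–(2.6); H. Kesten, PTRF 73 (1986) §2.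
-/

noncomputable section

namespace Summit.CriticalPhenomena.PercolationContinuityZ3.Theorems.Crossing

open MeasureTheory Literature.Probability.Percolation Literature.Probability.LatticeModels
open Literature.Probability.Percolation.DCT16
open Summit.CriticalPhenomena.PercolationContinuityZ3.Theorems.SurfaceTension
open scoped Literature.Probability.Percolation

variable {d : ℕ}

/-- **The two-sided one-level decomposition at a general aspect, ABSTRACT junk weight `J`** (Basu–Sapozhnikov (2.5)/(2.6) with hole and
source, Bernoulli case, under (A2)□(ϰ) with middle spheres `∂ⁱⁿΛ(σ m)` and outer boxes `Λ(τ m)`; the level junk is the hypothesis `hJ`).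
[cite: BasuSapozhnikov2017ECP, §2 eqs. (2.5)–(2.6)] -/
theorem sum_real_level_two_sided_junk (p : unitInterval) {ϰ : ℝ} (hϰ : 0 < ϰ)
    {σ τ : ℕ → ℕ} (hσ : ∀ m : ℕ, 1 ≤ m → m < σ m) (hστ : ∀ m : ℕ, 1 ≤ m → σ m < τ m)
    (J : ℕ → ℕ → ℝ)
    (hJ : ∀ ⦃m₁ m₂ n : ℕ⦄, 1 ≤ m₁ → m₁ ≤ m₂ → τ m₁ < σ m₂ → τ m₂ < n →
      ∀ ⦃H X : Finset (Site d)⦄, H ⊆ box d (m₁ - 1) → X ⊆ box d m₁ → (∀ x ∈ X, x ∉ H) →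
      ϰ ^ 2 * (bondPercolation (zdGraph d) p).real
          ({ω : BondConfig (Site d) | ∃ x ∈ X, ∃ t ∈ innerBoundary (zdGraph d) (box d n),
              ω ∈ openConnIn ((↑(box d n) : Set (Site d)) \ ↑H) x t} ∩
           {ω : BondConfig (Site d) | ∃ t₁ ∈ innerBoundary (zdGraph d) (box d (σ m₁)), ∃ w₁ ∈ innerBoundary (zdGraph d) (box d (σ m₂)),
               ∃ t₂ ∈ innerBoundary (zdGraph d) (box d (σ m₁)), ∃ w₂ ∈ innerBoundary (zdGraph d) (box d (σ m₂)),
               ω ∩ {e : Sym2 (Site d) | e ∈ (↑((box d (σ m₂)).sym2) : Set (Sym2 (Site d))) ∧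
                   ¬ (∀ v ∈ e, v ∈ box d (σ m₁)) ∧ ¬ (∀ v ∈ e, v ∈ innerBoundary (zdGraph d) (box d (σ m₂)))} ∈
                 openConnIn (↑(box d (σ m₂)) : Set (Site d)) t₁ w₁ ∧
               ω ∩ {e : Sym2 (Site d) | e ∈ (↑((box d (σ m₂)).sym2) : Set (Sym2 (Site d))) ∧
                   ¬ (∀ v ∈ e, v ∈ box d (σ m₁)) ∧ ¬ (∀ v ∈ e, v ∈ innerBoundary (zdGraph d) (box d (σ m₂)))} ∈
                 openConnIn (↑(box d (σ m₂)) : Set (Site d)) t₂ w₂ ∧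
               ω ∩ {e : Sym2 (Site d) | e ∈ (↑((box d (σ m₂)).sym2) : Set (Sym2 (Site d))) ∧
                   ¬ (∀ v ∈ e, v ∈ box d (σ m₁)) ∧ ¬ (∀ v ∈ e, v ∈ innerBoundary (zdGraph d) (box d (σ m₂)))} ∉
                 openConnIn (↑(box d (σ m₂)) : Set (Site d)) w₁ w₂}) ≤
        J m₁ m₂ * (bondPercolation (zdGraph d) p).real {ω : BondConfig (Site d) | ∃ x ∈ X, ∃ t ∈ innerBoundary (zdGraph d) (box d n),
            ω ∈ openConnIn ((↑(box d n) : Set (Site d)) \ ↑H) x t})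
    {m₁ m₂ n : ℕ} (hm₁ : 1 ≤ m₁) (hm₁₂ : m₁ ≤ m₂) (h12 : τ m₁ < σ m₂) (hn : τ m₂ < n)
    {H X : Finset (Site d)} (hH : H ⊆ box d (m₁ - 1)) (hX : X ⊆ box d m₁) (hXH : ∀ x ∈ X, x ∉ H)
    {E : Set (BondConfig (Site d))} {F : Finset (Sym2 (Site d))} (hE : DeterminedBy E ↑F) (hF : F ⊆ (box d (σ m₁)).sym2) :
    (bondPercolation (zdGraph d) p).real (E ∩ {ω : BondConfig (Site d) | ∃ x ∈ X, ∃ t ∈ innerBoundary (zdGraph d) (box d n),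
          ω ∈ openConnIn ((↑(box d n) : Set (Site d)) \ ↑H) x t}) -
        ϰ⁻¹ ^ 2 * J m₁ m₂ *
          (bondPercolation (zdGraph d) p).real {ω : BondConfig (Site d) | ∃ x ∈ X, ∃ t ∈ innerBoundary (zdGraph d) (box d n),
            ω ∈ openConnIn ((↑(box d n) : Set (Site d)) \ ↑H) x t} ≤
      ∑ UR ∈ ((box d (σ m₂)).powerset.filter (fun U => box d (σ m₁) ⊆ U)) ×ˢ (box d (σ m₂ + 1)).powerset,
        (bondPercolation (zdGraph d) p).real (E ∩
          {ω | ω ∩ (↑((box d (σ m₂ + 1)).sym2) : Set (Sym2 (Site d))) ∈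
            explEvent (↑(box d (σ m₁)) : Set (Site d)) ((↑(box d (σ m₂)) : Set (Site d)) \ ↑(box d (σ m₁))) ↑UR.1 ↑UR.2} ∩
          {ω | ∀ r ∈ UR.2, ∀ r' ∈ UR.2, ∃ v ∈ UR.1, ∃ v' ∈ UR.1,
            s(v, r) ∈ ω ∧ s(v', r') ∈ ω ∧ ω ∈ openConnIn ((↑UR.1 : Set (Site d)) \ ↑(box d (σ m₁ - 1))) v v'} ∩
          {ω | ∃ x ∈ X, ∃ r ∈ UR.2, ∃ v ∈ UR.1, ω ∈ openConnIn ((↑UR.1 : Set (Site d)) \ ↑H) x v ∧ s(v, r) ∈ ω}) *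
        (bondPercolation (zdGraph d) p).real {ω : BondConfig (Site d) | ∃ r ∈ UR.2, ∃ t ∈ innerBoundary (zdGraph d) (box d n),
            ω ∈ openConnIn ((↑(box d n) : Set (Site d)) \ ↑UR.1) r t} ∧
    ∑ UR ∈ ((box d (σ m₂)).powerset.filter (fun U => box d (σ m₁) ⊆ U)) ×ˢ (box d (σ m₂ + 1)).powerset,
        (bondPercolation (zdGraph d) p).real (E ∩
          {ω | ω ∩ (↑((box d (σ m₂ + 1)).sym2) : Set (Sym2 (Site d))) ∈
            explEvent (↑(box d (σ m₁)) : Set (Site d)) ((↑(box d (σ m₂)) : Set (Site d)) \ ↑(box d (σ m₁))) ↑UR.1 ↑UR.2} ∩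
          {ω | ∀ r ∈ UR.2, ∀ r' ∈ UR.2, ∃ v ∈ UR.1, ∃ v' ∈ UR.1,
            s(v, r) ∈ ω ∧ s(v', r') ∈ ω ∧ ω ∈ openConnIn ((↑UR.1 : Set (Site d)) \ ↑(box d (σ m₁ - 1))) v v'} ∩
          {ω | ∃ x ∈ X, ∃ r ∈ UR.2, ∃ v ∈ UR.1, ω ∈ openConnIn ((↑UR.1 : Set (Site d)) \ ↑H) x v ∧ s(v, r) ∈ ω}) *
        (bondPercolation (zdGraph d) p).real {ω : BondConfig (Site d) | ∃ r ∈ UR.2, ∃ t ∈ innerBoundary (zdGraph d) (box d n),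
            ω ∈ openConnIn ((↑(box d n) : Set (Site d)) \ ↑UR.1) r t} ≤
      (bondPercolation (zdGraph d) p).real (E ∩ {ω : BondConfig (Site d) | ∃ x ∈ X, ∃ t ∈ innerBoundary (zdGraph d) (box d n),
          ω ∈ openConnIn ((↑(box d n) : Set (Site d)) \ ↑H) x t}) := by
  classical
  have hσ1 := hσ m₁ hm₁
  have hστ1 := hστ m₁ hm₁
  have hσ2 := hσ m₂ (by omega)
  have hστ2 := hστ m₂ (by omega)
  set μ := bondPercolation (zdGraph d) p with hμ
  set a := σ m₁ with ha
  set b := σ m₂ with hb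
  have ha1 : 1 ≤ a := by omega
  have hab : a ≤ b := by omega
  have hab1 : a ≤ b - 1 := by omega
  have hbn : b + 1 < n := by omega
  have hHa : H ⊆ box d (a - 1) := hH.trans (box_mono d (by omega))
  have hXa : X ⊆ box d a := hX.trans (box_mono d (by omega))
  set CONN := {ω : BondConfig (Site d) | ∃ x ∈ X, ∃ t ∈ innerBoundary (zdGraph d) (box d n),
    ω ∈ openConnIn ((↑(box d n) : Set (Site d)) \ ↑H) x t} with hCONN
  set 𝒟 := ((box d b).powerset.filter (fun U => box d a ⊆ U)) ×ˢ (box d (b + 1)).powerset with h𝒟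
  set GOOD := ⋃ UR ∈ 𝒟, ({ω : BondConfig (Site d) | ω ∩ (↑((box d (b + 1)).sym2) : Set (Sym2 (Site d))) ∈
      explEvent (↑(box d a) : Set (Site d)) ((↑(box d b) : Set (Site d)) \ ↑(box d a)) ↑UR.1 ↑UR.2} ∩
    {ω | ∀ r ∈ UR.2, ∀ r' ∈ UR.2, ∃ v ∈ UR.1, ∃ v' ∈ UR.1,
      s(v, r) ∈ ω ∧ s(v', r') ∈ ω ∧ ω ∈ openConnIn ((↑UR.1 : Set (Site d)) \ ↑(box d (a - 1))) v v'}) with hGOOD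
  have hsum := sum_real_level_eq p hab hbn hHa hXa hE hF
  -- `hsum : Σ = μ.real (E ∩ CONN ∩ GOOD)`
  have hjunk := hJ hm₁ hm₁₂ h12 hn hH hX hXH
  have hdiff := real_inter_conn_diff_good_le (d := d) p (n := n) ha1 hab1 H X E
  have hϰ2 : 0 < ϰ ^ 2 := by positivity
  have hNU : μ.real ((E ∩ CONN) \ GOOD) ≤ ϰ⁻¹ ^ 2 * J m₁ m₂ * μ.real CONN := by
    refine hdiff.trans ?_
    rw [inv_pow, mul_assoc]
    exact (le_inv_mul_iff₀ hϰ2).2 hjunk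
  constructor
  · rw [hsum]
    have hsplit : μ.real (E ∩ CONN) ≤ μ.real (E ∩ CONN ∩ GOOD) + μ.real ((E ∩ CONN) \ GOOD) := by
      calc μ.real (E ∩ CONN) = μ.real ((E ∩ CONN ∩ GOOD) ∪ ((E ∩ CONN) \ GOOD)) := by rw [Set.inter_union_sdiff]
        _ ≤ _ := measureReal_union_le _ _
    linarith
  · rw [hsum]
    exact measureReal_mono (fun ω h => h.1) (measure_ne_top _ _)

end Summit.CriticalPhenomena.PercolationContinuityZ3.Theorems.Crossing

end
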